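import Literature.MathematicalPhysics.QuantumFieldTheory.Balaban1983to89.B9Eq3126KFloorWindowedDiagonal
import Literature.MathematicalPhysics.QuantumFieldTheory.Balaban1983to89.B9Thm311LaplaceAkPositiveDiagonal
import Literature.MathematicalPhysics.QuantumFieldTheory.Balaban1983to89.B9Eq384RemainderLetters
import Literature.MathematicalPhysics.QuantumFieldTheory.Balaban1983to89.B9Eq315QTowerLipschitzL2
import Literature.MathematicalPhysics.QuantumFieldTheory.Balaban1983to89.B9Eq315QTowerFlatNorm

/-!
# `Balaban1983to89.B9Eq3126H1BoundTowerVariational` — T. Bałaban, *Propagators for lattice gauge theories in a background field*, Commun. Math. Phys. **99**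
# (1985) 389–434 [Balaban1985BackgroundPropagators] (3.126) p. 420, Thm 3.11 p. 416, (3.79) p. 406, with T. Bałaban, *The variational problem and background
# fields in renormalization group method for lattice gauge theories*, Commun. Math. Phys. **102** (1985) 277–309 [Balaban1985Variational] (45)–(46) p. 285
# («B₀ … uniform»): **THE TWO `L²` LETTERS OF `H_{1,k}(U) = G_k(U)Q_k(U)†(Q_k(U)G_k(U)Q_k(U)†)⁻¹` — `‖(Q_kG_kQ_k†)⁻¹‖ ≤ C_K`, `‖H_{1,k}(U)‖ ≤ C_H` — ARE
# BOUNDED ON PRINT's DIAGONAL `ηL^{n+1} = 1`, `c₀(L^{n+1})^d = c₁` BY CONSTANTS CLOSED IN `(d, a, L, M_φ, M_φ′, r, C_τ, ρ_w)` FOR EVERY BACKGROUND IN THE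
# WINDOWS `‖U(b) − 1‖ ≤ αη`, `‖U(∂p) − 1‖ ≤ αη²`, `‖Ū^j − 1‖ ≤ αr^j`, `α ≤ α₀`: NO level count `n`, NO lattice spacing, NO volume, NO operator bound of
# `Δ^{(k)}_a(U)`, NO coercivity ∕ averaging ∕ transporter ∕ curvature letter displayed** (the end-point of this lineage's «variational currency for `H_{1,k}`»
# programme: `B9Eq3126GreenLettersVariational` → `…BondTentProfile` → `…BondTentLift` → `…BondLiftEnergy` → `…KFloorFlat` → `…KFloorDiagonal` →
# `…KFloorTowerDiagonal` → `…KFloorWindowedKit` → `…KFloorWindowedTower` → `…KFloorWindowedDiagonal` → this file)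

statement-level skeleton of published theorems with citation tags; proofs where landed; nothing here is a claim about the Yang–Mills mass gap

CITATION HEADER (lean-in-tree rule).  Audit cell `pub-balaban`, sub-cell `t4`, BINDER row NE9; filed by NE9 formalisation-swarm LEAF PROVER 02
(`b2b-balaban-t4-ne9-formalise-leaf-02`, gen 65) on the OWNER `b2b-balaban-t4-ne9-p1`'s tower chain (`B9Eq326OperatorTower.{QkW, laplaceAk}`, gen 85's
`B9Thm311LaplaceAkPositiveDiagonal.exists_coercive_laplaceAk_diagonal_closed`).  Sources: [Balaban1985BackgroundPropagators] pp. 395–397, 404–406, 416, 420;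
[Balaban1985Variational] p. 285; [Balaban1985Averaging] pp. 21, 36.

THE PRINT (verbatim).  [B11] p. 285: *«Let us define H = H₁. … the Theorem 3.12 from [5] implies |HB| ≤ B₀(L^jη)^{−1}|B|, |∇HB| ≤ B₀(L^jη)^{−2}|B| on Ω_j. (46)»*
with `B₀` uniform in the lattice and in `j`; [B9] p. 416, Thm 3.11: *«There exist positive constants α₀, γ₀ such that for U satisfying (3.79) with arbitrary
α₁ ≤ α₀ … the operators Δ′_a, G′, (Q′G′²Q′*)⁻¹, Δ_a, G are positive definite … and … uniformly bounded»*; p. 406, (3.79): the small-field windows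
*«|U(∂p) − 1| < α₁η², … |Ū^j(b) − 1| < α₁(L^jη)…»*; p. 420, (3.126): *«HB = GQ*(QGQ*)⁻¹B»*.

WHY THIS FILE (cell context).  The chain's operator-currency letters `C_H`, `C_K` (`B9Eq3126H1BoundTower`) scale like `M_T² ∝ |η|⁻⁴ = L^{4(n+1)}`; this
lineage's variational currency (`‖H₁b‖² ≤ γ⁻¹re⟨b, K⁻¹b⟩`, a `K`-floor from ONE explicit bond-tent test family) removed the operator bound, and the previous
file `B9Eq3126KFloorWindowedDiagonal` left only numerical letters: `‖η⁻¹‖εR`, `Kc`, `δQ`, `γ` (+ `hsym`, `hRS`).  Here they are DISCHARGED from the windows: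
`εR = 2M_φM_φ′αη` (`B9Eq384RemainderLetters.norm_adTransportW_sub_le`, so `‖η⁻¹‖εR = 2M_φM_φ′α`), `Kc = 32dC_τM_φ²(|η|^d∕c₀)α ≤ 32dC_τM_φ²ρ_w·α`
(`B9Ineq369CurvatureSmall.norm_inner_curvOp_self_le`), `δQ = M_φ′M_φ(e^{K_Lα∕(1−r)} − 1) ≤ 2M_φ′M_φK_Lα∕(1−r)` (`B9Eq315QTowerLipschitzL2.norm_QkW_sub_flat_le_L2_geometric`
at `√(c₁∕(c₀L′^d)) = 1`, `K_L = √(L^d)√(2d)·102(d+1)²L`; the pure-`d` smallness `δQ·1215(27∕4)^{d−1} ≤ 1∕2` holds once `α ≤ (1−r)∕((K_L+1)(4M_φ′M_φ·1215(27∕4)^{d−1}+1))`),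
`γ = γ₁` and its window ceiling `α₁` (the OWNER's `exists_coercive_laplaceAk_diagonal_closed`), `hRS`∕`hsym` from unitarity + `*`-trace + the compatibility of
the two normings (`B9Eq310HessianHermitian.adTransportW_adjoint`, `B9Eq326OperatorTower.laplaceAk_isSymmetric`).  So print's «B₀ independent of j» holds for the
chain's `L²` letters of `H_{1,k}(U)` with `B₀` a closed constant — the `H`-analogue of the OWNER's TOWER-R-PROGRAMME conclusion; the consumers
(`B9Eq3153FrakGkLipschitzTowerTwoBackgrounds`, `B9Eq386LipschitzH1TowerTwoBackgrounds`, the (3.99) assembly) may take `C_H`, `C_K` from here instead of from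
`M_T`.

WHAT IS PROVED (sorry-free; 0 `def`; [folklore] assembly of landed theorems + real arithmetic; nothing of [B9]∕[B11] asserted).
* **`exists_norm_KinvLatticeK_H1LatticeK_le_diagonal_closed`** — `∃ α₀ C_K C_H > 0` (closed: `α₀ = min(α₁, (1−r)∕((K_L+1)(4M_φ′M_φ·1215(27∕4)^{d−1}+1)))`,
  `C_K = 8Ξ(d,a) + 4(34d(2M_φM_φ′α₁)² + 32dC_τM_φ²ρ_wα₁ + 2a)(1215(27∕4)^{d−1})²`, `C_H = √(C_K∕γ₁)`) such that for every `n` with `3 ≤ L^{n+1}`, `η`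
  (`ηL^{n+1} = 1`), `c₀, c₁` (`c₀(L^{n+1})^d = c₁`, `|η|^d∕c₀ ≤ ρ_w`), `m`, background `U` of E162's data, unitary (`U(b)* = U(b)⁻¹`), `U(b) ∈ U1`, in the three
  windows with `0 ≤ α ≤ α₀`, and ANY `hpos`, `hQ`: `‖KinvLatticeK hpos hQ y‖ ≤ C_K‖y‖` and `‖H1LatticeK hpos hQ b‖ ≤ C_H‖b‖`.
HONEST SCOPE.  Crude constants; `1 ≤ d`, `3 ≤ L^{n+1}`, `a > 0`, `r < 1`, a bounded `*`-trace compatible with the Hilbert norming, `|η|^d∕c₀ ≤ ρ_w` displayed (the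
OWNER's letters, verbatim); `hpos`, `hQ` are ANY (inhabited on the diagonal by the OWNER's `exists_laplaceAk_pos_diagonal_closed` and `QkW_surjective`); NOT print's
kernel bound (46) ∕ [B9] Thm 3.12 (exponential decay) — only its `L²`-operator shadow; NOT NE9, NOT the route (cell pub-balaban: NE9 NOT PRINTED ∕ NOT PROVED; «NE9 ⇐
the named binders»; row WALLED ON A MODEL (O-NE9-1; #5 UNRULED); spine PROVED 0∕9; rung (B)+1 on a finite T⁴ — NOT infinite volume, NOT mass gap, NOT BetaPertH, NOT
Clay).  HONEST DEPENDENCY (cell line): continuum YM on T⁴ ⇐ BetaPertH ∧ nine spine estimates (0/9 proved); BetaPertH ⇐ (D1) ∧ (D4) ∧ CAP+tail; G-an2-4 gates asym,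
D1 and NE2/3/4.  NEW file importing `B9Eq3126KFloorWindowedDiagonal` (this lineage), `B9Thm311LaplaceAkPositiveDiagonal` (OWNER), `B9Eq384RemainderLetters`,
`B9Eq315QTowerLipschitzL2`, `B9Eq315QTowerFlatNorm`; nothing modified.  Net new unproved facts: 0.
-/

noncomputable section

open scoped InnerProductSpace ComplexConjugate BigOperators

namespace Literature.MathematicalPhysics.QuantumFieldTheory.Balaban1983to89.B9Eq3126H1BoundTowerVariational

open B4Sect5Torus (TSite)
open B9SectCLatticeCarrier (Bond)
open B9Eq319QprimeTorus (fineP)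
open B11Eq103H1Complex (BondL2K H1LatticeK KinvLatticeK)
open B9Eq310HessianOperator (adTransportW curvOp)
open B9Eq310HessianHermitian (adTransportW_adjoint)
open B9Eq310DeltaPrime (plaqHolU)
open B9Eq315QTorus (perCfg cornerSite)
open B9Eq315QTower (towerP UlevOf)
open B9Eq315QTowerFlat (perCfg_UlevOf_one_mem_U1 norm_Wcx_UlevOf_one_sub_one_le)
open B9Eq315QTowerFlatNorm (flat_oneStep_data_pow)
open B9Eq315QTowerLipschitzL2 (norm_QkW_sub_flat_le_L2_geometric)
open B9Eq316TowerFlatIsOneStep (towerP_eq_fineP_pow)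
open B9Eq326OperatorTower (QkW laplaceAk laplaceAk_isSymmetric)
open B9Eq384RemainderLetters (norm_adTransportW_sub_le)
open B7Prop1Explicit (U1 Wcx boxVec)
open B9Ineq369CurvatureSmall (norm_inner_curvOp_self_le)
open B9Thm311LaplaceAkPositiveDiagonal (exists_coercive_laplaceAk_diagonal_closed)
open B9Eq3126KFloorWindowedDiagonal (norm_KinvLatticeK_H1LatticeK_tower_windowed_le_diagonal)

variable {d : ℕ} (hd : 1 ≤ d) (L : ℕ) [NeZero L] (hL : 1 ≤ L)
  {𝔸 : Type*} [NormedRing 𝔸] [NormedAlgebra ℂ 𝔸] [CompleteSpace 𝔸] [NormOneClass 𝔸] [StarRing 𝔸] [NormedStarGroup 𝔸] [StarModule ℂ 𝔸]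
  {W : Type*} [NormedAddCommGroup W] [InnerProductSpace ℂ W] [FiniteDimensional ℂ W] (φ : W ≃ₗ[ℂ] 𝔸)
  {Mφ Mφ' : ℝ} (hMφ : 0 ≤ Mφ) (hMφ' : 0 ≤ Mφ') (hφ : ∀ w, ‖φ w‖ ≤ Mφ * ‖w‖) (hφ' : ∀ X, ‖φ.symm X‖ ≤ Mφ' * ‖X‖)
  {a : ℝ} (ha : 0 < a) {r : ℝ} (hr0 : 0 ≤ r) (hr1 : r < 1)
  (τ : 𝔸 →ₗ[ℂ] ℂ) {Cτ : ℝ} (hτ : ∀ X, ‖τ X‖ ≤ Cτ * ‖X‖) (hCτ : 0 ≤ Cτ) {ρw : ℝ} (hρw : 0 ≤ ρw)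
  (hτ₁ : ∀ X : 𝔸, τ (star X) = conj (τ X)) (hτ₂ : ∀ X Y : 𝔸, τ (X * Y) = τ (Y * X))
  (hφτ : ∀ X Y : 𝔸, ⟪φ.symm X, φ.symm Y⟫_ℂ = τ (star X * Y))

include hd hMφ hMφ' hφ hφ' ha hr0 hr1 hτ hCτ hρw hτ₁ hτ₂ hφτ

/-- **THE TWO `L²` LETTERS OF `H_{1,k}(U)` ARE LEVEL-FREE ON THE DIAGONAL — CLOSED FORM; NO OPERATOR, COERCIVITY, AVERAGING, TRANSPORTER OR CURVATURE
LETTER DISPLAYED.**  There are `α₀, C_K, C_H > 0`, closed in `(d, a, L, M_φ, M_φ′, r, C_τ, ρ_w)`, such that for every `n` (`3 ≤ L^{n+1}`), `η` (`ηL^{n+1} = 1`),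
`c₀, c₁` (`c₀(L^{n+1})^d = c₁`, `|η|^d∕c₀ ≤ ρ_w`), `m`, every background `U` of E162's data which is unitary, `U(b) ∈ U1`, in the windows `‖U(b) − 1‖ ≤ αη`,
`‖U(∂p) − 1‖ ≤ αη²`, `‖Ū^j(b) − 1‖ ≤ ε_j ≤ αr^j` with `0 ≤ α ≤ α₀`, and ANY positivity ∕ surjectivity witnesses `hpos`, `hQ`:
`‖(Q_k(U)G_k(U)Q_k(U)†)⁻¹y‖ ≤ C_K‖y‖` and `‖H_{1,k}(U)b‖ ≤ C_H‖b‖` — the windowed diagonal K-floor (`B9Eq3126KFloorWindowedDiagonal`) with `εR = 2M_φM_φ′αη`,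
`Kc = 32dC_τM_φ²(|η|^d∕c₀)α`, `δQ = M_φ′M_φ(e^{K_Lα∕(1−r)} − 1)`, `γ = γ₁` inhabited from the windows and the OWNER's closed coercivity, then monotonicity in
`α ≤ α₁`. [folklore] [cite: Balaban1985BackgroundPropagators, (3.126) p.420, Thm 3.11 p.416, (3.79) p.406, (3.70) p.404, (3.35) p.397; Balaban1985Variational, (45)–(46) p.285] -/
theorem exists_norm_KinvLatticeK_H1LatticeK_le_diagonal_closed :
    ∃ α₀ CK CH : ℝ, 0 < α₀ ∧ 0 < CK ∧ 0 < CH ∧ ∀ (n : ℕ) (η : ℝ), η * (L : ℝ) ^ (n + 1) = 1 → 3 ≤ L ^ (n + 1) →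
      ∀ (c₀ c₁ : ℝ) [Fact (0 < c₀)] [Fact (0 < c₁)], c₀ * ((L : ℝ) ^ (n + 1)) ^ d = c₁ → |η| ^ d / c₀ ≤ ρw →
      ∀ (m : Fin d → ℕ) [∀ i, NeZero (m i)] (U : Bond d (towerP L m (n + 1)) → 𝔸ˣ) (αU : ℕ → ℝ) (hα1 : ∀ j, αU j ≤ 1 / 64)
        (hU1 : ∀ (j : ℕ) (x : B7Prop1Explicit.Site d) (κ : Fin d), perCfg (towerP L m (j + 1)) (UlevOf L m (n + 1) U j) x κ ∈ U1 𝔸)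
        (hreg : ∀ (j : ℕ) (y : TSite d (towerP L m j)) (κ : Fin d) (r : Fin d → Fin L),
          ‖((Wcx L (perCfg (towerP L m (j + 1)) (UlevOf L m (n + 1) U j)) (cornerSite L y) κ (boxVec L r) : 𝔸ˣ) : 𝔸) - 1‖ ≤ αU j)
        (εU : ℕ → ℝ), (∀ j, 0 ≤ εU j) → (∀ (j : ℕ) (b : Bond d (towerP L m (j + 1))), ‖(UlevOf L m (n + 1) U j b : 𝔸) - 1‖ ≤ εU j) →
      ∀ {α : ℝ}, 0 ≤ α → α ≤ α₀ →
        (∀ b, star (U b : 𝔸) = (((U b)⁻¹ : 𝔸ˣ) : 𝔸)) →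
        (∀ b, U b ∈ U1 𝔸) → (∀ b, ‖(U b : 𝔸) - 1‖ ≤ α * η) →
        (∀ p : B9SectCLatticeCarrier.Plaq d (towerP L m (n + 1)), ‖(plaqHolU U p : 𝔸) - 1‖ ≤ α * η ^ 2) →
        (∀ j < n + 1, εU j ≤ α * r ^ j) →
        ∀ (hpos : ∀ x : BondL2K ℂ d (towerP L m (n + 1)) c₀ W, x ≠ 0 →
            0 < RCLike.re ⟪x, laplaceAk L m n φ η U hL αU hα1 hU1 hreg τ (c₀ := c₀) (c₁ := c₁) a x⟫_ℂ)
          (hQ : Function.Surjective (QkW L m n φ U hL αU hα1 hU1 hreg (c₀ := c₀) (c₁ := c₁))),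
          (∀ y : BondL2K ℂ d m c₁ W, ‖KinvLatticeK hpos hQ y‖ ≤ CK * ‖y‖) ∧
            ∀ b : BondL2K ℂ d m c₁ W, ‖H1LatticeK hpos hQ b‖ ≤ CH * ‖b‖ := by
  obtain ⟨α₁, γ₁, hα₁, hγ₁, Hγ⟩ := exists_coercive_laplaceAk_diagonal_closed (d := d) L hL φ hMφ hMφ' hφ hφ' ha hr0 hr1 τ hτ hCτ hρw
  have h1r : 0 < 1 - r := by linarith
  have hν1 : (1 : ℝ) ≤ 1215 * ((27 : ℝ) / 4) ^ (d - 1) := by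
    have := one_le_pow₀ (by norm_num : (1 : ℝ) ≤ 27 / 4) (n := d - 1)
    linarith
  have hKL0 : 0 ≤ Real.sqrt ((L : ℝ) ^ d) * (Real.sqrt (2 * d) * (102 * ((d : ℝ) + 1) ^ 2 * L)) := by positivity
  have hMM : 0 ≤ Mφ' * Mφ := mul_nonneg hMφ' hMφ
  -- the window ceiling: the coercivity ceiling `α₁` and the averaging ceiling `α₂`
  refine ⟨min α₁ ((1 - r) / ((Real.sqrt ((L : ℝ) ^ d) * (Real.sqrt (2 * d) * (102 * ((d : ℝ) + 1) ^ 2 * L)) + 1) *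
      (4 * (Mφ' * Mφ) * (1215 * ((27 : ℝ) / 4) ^ (d - 1)) + 1))),
    8 * (180 * (d : ℝ) * 1215 ^ 2 * ((27 : ℝ) ^ 2 / 4 ^ 2) ^ (d - 1) + 2 * a * (1215 / 12) ^ 2 * ((27 : ℝ) ^ 2 / 6 ^ 2) ^ (d - 1)) +
      4 * (34 * (d : ℝ) * (2 * Mφ * Mφ' * α₁) ^ 2 + 32 * d * Cτ * Mφ ^ 2 * ρw * α₁ + 2 * a * 1) * (1215 * ((27 : ℝ) / 4) ^ (d - 1)) ^ 2,
    Real.sqrt ((8 * (180 * (d : ℝ) * 1215 ^ 2 * ((27 : ℝ) ^ 2 / 4 ^ 2) ^ (d - 1) + 2 * a * (1215 / 12) ^ 2 * ((27 : ℝ) ^ 2 / 6 ^ 2) ^ (d - 1)) +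
      4 * (34 * (d : ℝ) * (2 * Mφ * Mφ' * α₁) ^ 2 + 32 * d * Cτ * Mφ ^ 2 * ρw * α₁ + 2 * a * 1) * (1215 * ((27 : ℝ) / 4) ^ (d - 1)) ^ 2) / γ₁),
    lt_min hα₁ (by positivity), by positivity, by positivity, ?_⟩
  intro n η hηL hL3 c₀ c₁ _ _ hw hρ m _ U αU hα1 hU1 hreg εU hεU hUε α hα0 hαle hUst hUb hUη hpl hεg hpos hQ
  have hc₀ : 0 < c₀ := Fact.out
  have hc₁ : 0 < c₁ := Fact.out
  have hLr : (0 : ℝ) < (L : ℝ) ^ (n + 1) := by positivity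
  have hηL0 : 0 < η * (L : ℝ) ^ (n + 1) := by rw [hηL]; exact one_pos
  have hη0 : 0 < η := pos_of_mul_pos_left hηL0 hLr.le
  have hαle₁ : α ≤ α₁ := hαle.trans (min_le_left _ _)
  have hαle₂ : α ≤ (1 - r) / ((Real.sqrt ((L : ℝ) ^ d) * (Real.sqrt (2 * d) * (102 * ((d : ℝ) + 1) ^ 2 * L)) + 1) * (4 * (Mφ' * Mφ) * (1215 * ((27 : ℝ) / 4) ^ (d - 1)) + 1)) := hαle.trans (min_le_right _ _)
  /- §A. THE REAL ARITHMETIC (done first, in a small context: every `positivity` ∕ `nlinarith` below sees only numbers). -/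
  have hP1 : 0 ≤ 2 * Mφ * Mφ' := by positivity
  have hP2 : 0 ≤ 32 * (d : ℝ) * Cτ * Mφ ^ 2 := by positivity
  have hP3 : 0 ≤ 34 * (d : ℝ) := by positivity
  have hP4 : 0 ≤ 2 * a := by positivity
  have hP5 : 0 < (Real.sqrt ((L : ℝ) ^ d) * (Real.sqrt (2 * d) * (102 * ((d : ℝ) + 1) ^ 2 * L)) + 1) * (4 * (Mφ' * Mφ) * (1215 * ((27 : ℝ) / 4) ^ (d - 1)) + 1) := by positivity
  have hP6 : 0 < 4 * (Mφ' * Mφ) * (1215 * ((27 : ℝ) / 4) ^ (d - 1)) + 1 := by positivity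
  have hν0 : 0 ≤ (1215 * ((27 : ℝ) / 4) ^ (d - 1)) := by positivity
  have hεR0 : 0 ≤ 2 * Mφ * Mφ' * (α * η) := by positivity
  have hKc0 : 0 ≤ 32 * (d : ℝ) * Cτ * Mφ ^ 2 * (|η| ^ d / c₀) * (‖((η : ℂ))⁻¹‖ ^ 2 * (α * η ^ 2)) := by positivity
  have hαη2 : 0 ≤ α * η ^ 2 := by positivity
  have hnη : ‖((η : ℂ))⁻¹‖ = η⁻¹ := by rw [norm_inv, Complex.norm_real, Real.norm_eq_abs, abs_of_pos hη0]
  have e1 : ‖((η : ℂ))⁻¹‖ * (2 * Mφ * Mφ' * (α * η)) = 2 * Mφ * Mφ' * α := by rw [hnη]; field_simp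
  have e2 : ‖((η : ℂ))⁻¹‖ ^ 2 * (α * η ^ 2) = α := by rw [hnη]; field_simp
  -- the averaging letter is small: `x := K_L·α∕(1−r) ≤ 1∕(4M′Mν + 1) ≤ 1`, `e^x − 1 ≤ 2x`
  have hx0 : 0 ≤ Real.sqrt ((L : ℝ) ^ d) * (Real.sqrt (2 * d) * (102 * ((d : ℝ) + 1) ^ 2 * L)) * (α / (1 - r)) :=
    mul_nonneg hKL0 (div_nonneg hα0 h1r.le)
  have hx1 : Real.sqrt ((L : ℝ) ^ d) * (Real.sqrt (2 * d) * (102 * ((d : ℝ) + 1) ^ 2 * L)) * (α / (1 - r)) ≤ 1 / (4 * (Mφ' * Mφ) * (1215 * ((27 : ℝ) / 4) ^ (d - 1)) + 1) := by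
    rw [le_div_iff₀ hP5] at hαle₂
    rw [mul_div_assoc', div_le_iff₀ h1r, div_mul_eq_mul_div, le_div_iff₀ hP6, one_mul]
    nlinarith only [hαle₂, mul_nonneg hα0 hP6.le]
  have hxle1 : Real.sqrt ((L : ℝ) ^ d) * (Real.sqrt (2 * d) * (102 * ((d : ℝ) + 1) ^ 2 * L)) * (α / (1 - r)) ≤ 1 := hx1.trans (by rw [div_le_one hP6]; linarith only [mul_nonneg hMM hν0])
  have hexp : Real.exp (Real.sqrt ((L : ℝ) ^ d) * (Real.sqrt (2 * d) * (102 * ((d : ℝ) + 1) ^ 2 * L)) * (α / (1 - r))) - 1 ≤ 2 * (Real.sqrt ((L : ℝ) ^ d) * (Real.sqrt (2 * d) * (102 * ((d : ℝ) + 1) ^ 2 * L)) * (α / (1 - r))) := by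
    have h := Real.abs_exp_sub_one_le (x := Real.sqrt ((L : ℝ) ^ d) * (Real.sqrt (2 * d) * (102 * ((d : ℝ) + 1) ^ 2 * L)) * (α / (1 - r))) (by rwa [abs_of_nonneg hx0])
    rw [abs_of_nonneg hx0] at h
    exact (le_abs_self _).trans h
  have hexp0 : 0 ≤ Real.exp (Real.sqrt ((L : ℝ) ^ d) * (Real.sqrt (2 * d) * (102 * ((d : ℝ) + 1) ^ 2 * L)) * (α / (1 - r))) - 1 := by rw [sub_nonneg]; exact Real.one_le_exp hx0
  have hδQ0 : 0 ≤ Mφ' * Mφ * (Real.exp (Real.sqrt ((L : ℝ) ^ d) * (Real.sqrt (2 * d) * (102 * ((d : ℝ) + 1) ^ 2 * L)) * (α / (1 - r))) - 1) := mul_nonneg hMM hexp0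
  have hδQle : Mφ' * Mφ * (Real.exp (Real.sqrt ((L : ℝ) ^ d) * (Real.sqrt (2 * d) * (102 * ((d : ℝ) + 1) ^ 2 * L)) * (α / (1 - r))) - 1) ≤ 2 * (Mφ' * Mφ) / (4 * (Mφ' * Mφ) * (1215 * ((27 : ℝ) / 4) ^ (d - 1)) + 1) := by
    calc Mφ' * Mφ * (Real.exp (Real.sqrt ((L : ℝ) ^ d) * (Real.sqrt (2 * d) * (102 * ((d : ℝ) + 1) ^ 2 * L)) * (α / (1 - r))) - 1) ≤ Mφ' * Mφ * (2 * (1 / (4 * (Mφ' * Mφ) * (1215 * ((27 : ℝ) / 4) ^ (d - 1)) + 1))) := mul_le_mul_of_nonneg_left (hexp.trans (by linarith only [hx1])) hMM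
      _ = 2 * (Mφ' * Mφ) / (4 * (Mφ' * Mφ) * (1215 * ((27 : ℝ) / 4) ^ (d - 1)) + 1) := by ring
  have hδν : Mφ' * Mφ * (Real.exp (Real.sqrt ((L : ℝ) ^ d) * (Real.sqrt (2 * d) * (102 * ((d : ℝ) + 1) ^ 2 * L)) * (α / (1 - r))) - 1) * (1215 * ((27 : ℝ) / 4) ^ (d - 1)) ≤ 1 / 2 := by
    refine (mul_le_mul_of_nonneg_right hδQle hν0).trans ?_
    rw [div_mul_eq_mul_div, div_le_iff₀ hP6]
    linarith only [mul_nonneg hMM hν0]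
  have hδ1 : Mφ' * Mφ * (Real.exp (Real.sqrt ((L : ℝ) ^ d) * (Real.sqrt (2 * d) * (102 * ((d : ℝ) + 1) ^ 2 * L)) * (α / (1 - r))) - 1) ≤ 1 := by
    refine hδQle.trans ?_
    rw [div_le_one hP6]
    linarith only [mul_le_mul_of_nonneg_left hν1 hMM, hMM]
  -- monotonicity of `Ξ_U` in the letters: `‖η⁻¹‖εR = 2M_φM_φ′α ≤ 2M_φM_φ′α₁`, `Kc = 32dC_τM_φ²(|η|^d∕c₀)α ≤ 32dC_τM_φ²ρ_w α₁`, `δQ² ≤ 1`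
  have i1 : (2 * Mφ * Mφ' * α) ^ 2 ≤ (2 * Mφ * Mφ' * α₁) ^ 2 := pow_le_pow_left₀ (mul_nonneg hP1 hα0) (mul_le_mul_of_nonneg_left hαle₁ hP1) 2
  have i2 : 32 * (d : ℝ) * Cτ * Mφ ^ 2 * (|η| ^ d / c₀) * α ≤ 32 * d * Cτ * Mφ ^ 2 * ρw * α₁ :=
    mul_le_mul (mul_le_mul_of_nonneg_left hρ hP2) hαle₁ hα0 (mul_nonneg hP2 hρw)
  have i3 : (Mφ' * Mφ * (Real.exp (Real.sqrt ((L : ℝ) ^ d) * (Real.sqrt (2 * d) * (102 * ((d : ℝ) + 1) ^ 2 * L)) * (α / (1 - r))) - 1)) ^ 2 ≤ 1 := pow_le_one₀ hδQ0 hδ1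
  have hmono : 8 * (180 * (d : ℝ) * 1215 ^ 2 * ((27 : ℝ) ^ 2 / 4 ^ 2) ^ (d - 1) + 2 * a * (1215 / 12) ^ 2 * ((27 : ℝ) ^ 2 / 6 ^ 2) ^ (d - 1)) +
      4 * (34 * (d : ℝ) * (‖((η : ℂ))⁻¹‖ * (2 * Mφ * Mφ' * (α * η))) ^ 2 + 32 * d * Cτ * Mφ ^ 2 * (|η| ^ d / c₀) * (‖((η : ℂ))⁻¹‖ ^ 2 * (α * η ^ 2)) +
        2 * a * (Mφ' * Mφ * (Real.exp (Real.sqrt ((L : ℝ) ^ d) * (Real.sqrt (2 * d) * (102 * ((d : ℝ) + 1) ^ 2 * L)) * (α / (1 - r))) - 1)) ^ 2) * (1215 * ((27 : ℝ) / 4) ^ (d - 1)) ^ 2 ≤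
      8 * (180 * (d : ℝ) * 1215 ^ 2 * ((27 : ℝ) ^ 2 / 4 ^ 2) ^ (d - 1) + 2 * a * (1215 / 12) ^ 2 * ((27 : ℝ) ^ 2 / 6 ^ 2) ^ (d - 1)) + 4 * (34 * (d : ℝ) * (2 * Mφ * Mφ' * α₁) ^ 2 + 32 * d * Cτ * Mφ ^ 2 * ρw * α₁ + 2 * a * 1) * (1215 * ((27 : ℝ) / 4) ^ (d - 1)) ^ 2 := by
    rw [e1, e2]
    have hsum : 34 * (d : ℝ) * (2 * Mφ * Mφ' * α) ^ 2 + 32 * d * Cτ * Mφ ^ 2 * (|η| ^ d / c₀) * α + 2 * a * (Mφ' * Mφ * (Real.exp (Real.sqrt ((L : ℝ) ^ d) * (Real.sqrt (2 * d) * (102 * ((d : ℝ) + 1) ^ 2 * L)) * (α / (1 - r))) - 1)) ^ 2 ≤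
        34 * (d : ℝ) * (2 * Mφ * Mφ' * α₁) ^ 2 + 32 * d * Cτ * Mφ ^ 2 * ρw * α₁ + 2 * a * 1 :=
      add_le_add (add_le_add (mul_le_mul_of_nonneg_left i1 hP3) i2) (mul_le_mul_of_nonneg_left i3 hP4)
    linarith only [mul_le_mul_of_nonneg_right hsum (sq_nonneg (1215 * ((27 : ℝ) / 4) ^ (d - 1)))]
  /- §B. THE LETTERS OF THE WINDOWED FILE, DERIVED: adjointness, symmetry, coercivity, transporter, curvature form, averaging. -/
  have hRS : ∀ (b : Bond d (towerP L m (n + 1))) (v u : W), ⟪adTransportW φ U b v, u⟫_ℂ = ⟪v, adTransportW φ (fun b => (U b)⁻¹) b u⟫_ℂ :=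
    adTransportW_adjoint φ τ hτ₂ hUst hφτ
  have hsym := laplaceAk_isSymmetric L m n φ η U hL αU hα1 hU1 hreg τ (c₀ := c₀) (c₁ := c₁) hUst hτ₁ hτ₂ hφτ a
  have hγ := Hγ n η hηL c₀ c₁ hw hρ m U αU hα1 hU1 hreg εU hεU hUε hα0 hαle₁ hRS hUb hUη hpl hεg
  have hR : ∀ (b : Bond d (towerP L m (n + 1))) (w : W), ‖adTransportW φ U b w - w‖ ≤ 2 * Mφ * Mφ' * (α * η) * ‖w‖ := fun b w =>
    norm_adTransportW_sub_le φ hφ hφ' hMφ' U b (hUb b) (hUη b) w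
  have hUb' : ∀ b : Bond d (towerP L m (n + 1)), ‖(U b : 𝔸)‖ ≤ 1 ∧ ‖(((U b)⁻¹ : 𝔸ˣ) : 𝔸)‖ ≤ 1 := fun b => B7Prop1Explicit.mem_U1.1 (hUb b)
  have hcurv := fun x : BondL2K ℂ d (towerP L m (n + 1)) c₀ W => norm_inner_curvOp_self_le φ hτ hCτ hφ η hUb' hpl hαη2 x
  have hQd := norm_QkW_sub_flat_le_L2_geometric L m n hL φ hMφ hMφ' hφ hφ' (c₀ := c₀) (c₁ := c₁) U αU hα1 hU1 hreg εU hεU hUε hr0 hr1 hα0 hεg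
  have hsq1 : Real.sqrt (c₁ / (c₀ * ((L : ℝ) ^ (n + 1)) ^ d)) = 1 := by
    rw [← hw, div_self (mul_pos hc₀ (pow_pos hLr d)).ne', Real.sqrt_one]
  simp only [hsq1, mul_one] at hQd
  -- the one-step flat letters at block `L^{n+1}` and print's point in the `ℕ`-cast form
  obtain ⟨hU1', hreg'⟩ := flat_oneStep_data_pow (𝔸 := 𝔸) L m n
  have hη' : η * (((L ^ (n + 1) : ℕ) : ℝ)) = 1 := by rwa [Nat.cast_pow]
  have hw' : c₀ * (((L ^ (n + 1) : ℕ) : ℝ)) ^ d = c₁ := by rwa [Nat.cast_pow]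
  have hLk : 1 ≤ L ^ (n + 1) := Nat.one_le_pow _ _ hL
  /- §C. THE WINDOWED DIAGONAL FILE, then monotonicity. -/
  obtain ⟨hK, hH⟩ := norm_KinvLatticeK_H1LatticeK_tower_windowed_le_diagonal L m n hL φ η τ U αU hα1 hU1 hreg (fun _ => 0) (fun _ => by norm_num)
    (perCfg_UlevOf_one_mem_U1 L m (n + 1)) (norm_Wcx_UlevOf_one_sub_one_le L m (n + 1) (fun _ => 0) (fun _ => le_rfl)) hLk
    (by norm_num : (0 : ℝ) ≤ 1 / 64) hU1' hreg' (towerP_eq_fineP_pow L m (n + 1)) hL3 hd hη' hw' ha hRS hsym hεR0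
    hR hKc0 hcurv hδQ0 hQd hδν hγ₁ hγ hpos hQ
  exact ⟨fun y => (hK y).trans (mul_le_mul_of_nonneg_right hmono (norm_nonneg _)), fun b =>
    (hH b).trans (mul_le_mul_of_nonneg_right (Real.sqrt_le_sqrt (div_le_div_of_nonneg_right hmono hγ₁.le)) (norm_nonneg _))⟩

end Literature.MathematicalPhysics.QuantumFieldTheory.Balaban1983to89.B9Eq3126H1BoundTowerVariational

end
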